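/-
Copyright: the b2b-balaban T⁴-continuum CRUX team, row NE7b OWNER lineage `t4-ne7b-p1` (gen 145). Project licence.
-/
import Summits.QuantumFields.BalabanUV.T4Continuum.Spine.NE7b.SupFiniteRangeGeometryLetters

/-!
# THE WEIGHTED PROFILE LETTERS FROM INTRINSIC WEIGHTED LETTERS — NO FINITE RANGE (SCOPING-d17 (R-b), the repair of the located
# non-closure (N2), first file).  (476) DISCHARGED the weighted hypotheses of the kernel-letter class map — the profile letters `αθ, βθ` of
# the observables' vectors `a^v_w = Σ_u|A_{uw}|Hk_{vu}` against `σ_{vw} = e^{c·d(p v,q w)}` and the weighted smallness `γθ, γθ′` of the whitened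
# Dobrushin matrix against `θ_{xw} = e^{c·d(q x,q w)}` — from PLAIN letters times a range factor `e^{c(R+R′)}`, `R′` the RANGE of `Hk`.  The
# OUTPUT majorants `Hk⁺, K3⁺, …` of a step have infinite range (exponential tails), so at the second step that discharge is void (SCOPING-d17
# §B (N2)).  THIS FILE discharges the same four letters from INTRINSIC WEIGHTED LETTERS of the majorant — `Σ_u Hk_{vu}e^{c·d(p v,p u)} ≤ hrϑ`
# (rows), `Σ_v Hk_{vu}e^{c·d(p v,p u)} ≤ hcϑ` (columns) — and of the factor — `Σ_w|A_{uw}|e^{c·d(p u,q w)} ≤ αrσ`, `Σ_u|A_{uw}|e^{c·d(p u,q w)} ≤ αcσ`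
# — by the TRIANGLE INEQUALITY alone (`e^{c·d(p v,q w)} ≤ e^{c·d(p v,p u)}·e^{c·d(p u,q w)}`, (476) `expw_triangle`):
#   `αθ = hrϑ·αrσ`,  `βθ ≤ αθ`,  `γθ = αcσ·hrϑ·αrσ∕(1−lamA)`,  `γθ′ = αcσ·hcϑ·αrσ∕(1−lamA)`,
# stated for a GENERIC nonnegative profile `f` anchored at a site (§1), so the `K3`-, `K4`-vector profiles of orders 4–5 (`hgσ`, `hkσ`) are
# the same lemma with `f := K3_{pq·}`, `K4_{pqo·}` (§2); §3: a finite-range majorant HAS the intrinsic letters (`hrϑ = e^{cR′}·hr`), so the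
# new hypotheses contain (476)'s case (row NE7b, node U5c; (476) `expw_triangle`, `weight_le_of_support`, (456) BY NAME; [folklore]).  With
# these, the weighted class's step needs only the factor's weighted letters (finite range per step) and the majorants' intrinsic weighted
# letters, which the output CAN reproduce ((R-c), next files).

Cell `pub-balaban`, sub-cell `t4`, spine estimate NE7b (`T4WeightBudget.RelWeightBound`; the cell's OWN estimate — NOT PRINTED in
[Bałaban 1983–89], NOT PROVED).  Crux-route work under `Spine/NE7b/` by the row OWNER (`t4-ne7b-p1` gen 145, file (651)) under FREEZE
(0)'s crux-prover clause; NOTHING of Bałaban's is named as a Lean object, valued or asserted; no `T4Continuum/Support` leaf typed; no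
`def`, no notation (weights WRITTEN OUT as `Real.exp (c * dist …)`); zero `sorry`.  Imports (BY NAME): the OWNER's (476)
`…SupFiniteRangeGeometryLetters` (`expw_triangle`, `weight_le_of_support`; (456) `whitened_cross_nonneg`, `whitened_obs_nonneg` through it).

WHAT IS PROVED ([folklore]; `X` pseudometric, rate `c ≥ 0`): §1 **`profile_weighted_rowsum_le`** (`αθ`), `profile_weighted_entry_le` (`βθ`),
**`cross_weighted_rowsum_le`** (`γθ`), **`cross_weighted_colsum_le`** (`γθ′`); §2 `hessian_profile_letter`, `third_profile_letter`,
`fourth_profile_letter` (the class's instances); §3 `weighted_rowsum_of_finite_range`, `weighted_colsum_of_finite_range` ((476)'s case); §4 toy.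

HONEST (what this is NOT).  Letter transport only; the intrinsic weighted letters of the OUTPUT majorants ((R-c)), the interpolated slot
letters ((R-a)) and the rate bookkeeping ((R-d)) are the next files; scalar skeleton ((A3), NC-NE7b-α UNRULED); nothing of Bałaban's
asserted.  BY-NAME EFFECT ON THE WALL: NONE.  NE7b NOT PRINTED ∕ NOT PROVED; spine PROVED 0∕9; rung (B)+1 — the programme's measures remain
FINITE-torus statements; NOT the mass gap, NOT Clay.  HONEST DEPENDENCY: continuum YM on T⁴ ⇐ BetaPertH ∧ nine spine estimates (0∕9 proved);
BetaPertH ⇐ (D1) ∧ (D4) ∧ CAP+tail; G-an2-4 gates asym, D1 and NE2∕3∕4.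
-/

set_option autoImplicit false

noncomputable section

namespace Summit.QuantumFields.BalabanUV.T4Continuum.NE7b.SupWeightedProfileLetters

open Finset Real Matrix
open scoped BigOperators
open SupFiniteRangeGeometryLetters (expw_triangle weight_le_of_support)
open SupWhitenedFirstOrderLetters (whitened_cross_nonneg whitened_obs_nonneg)

variable {ι κ X : Type} [Fintype ι] [Fintype κ] [DecidableEq κ] [PseudoMetricSpace X]

/-! ## §1. Generic profiles: the four weighted letters by the triangle inequality -/

section Generic

variable {A : Matrix ι κ ℝ} {p : ι → X} {q : κ → X} {c αrσ αcσ : ℝ}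

omit [DecidableEq κ] in
/-- **THE WEIGHTED PROFILE LETTER `αθ` WITHOUT FINITE RANGE**: a nonnegative profile `f` anchored at `s` with intrinsic weighted letter
`Σ_u f_u·e^{c·d(s,p u)} ≤ F` and a factor with weighted row letter `Σ_w|A_{uw}|e^{c·d(p u,q w)} ≤ αrσ` (`αrσ ≥ 0`) give
`Σ_w (Σ_u|A_{uw}|f_u)·e^{c·d(s,q w)} ≤ F·αrσ`. [folklore] -/
theorem profile_weighted_rowsum_le {f : ι → ℝ} {s : X} {F : ℝ} (hc : 0 ≤ c) (hf0 : ∀ u, 0 ≤ f u)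
    (hF : ∑ u, f u * Real.exp (c * dist s (p u)) ≤ F) (hα0 : 0 ≤ αrσ) (hA : ∀ u, ∑ w, |A u w| * Real.exp (c * dist (p u) (q w)) ≤ αrσ) :
    ∑ w, (∑ u, |A u w| * f u) * Real.exp (c * dist s (q w)) ≤ F * αrσ := by
  -- termwise triangle inequality, then swap the sums
  have h1 : ∑ w, (∑ u, |A u w| * f u) * Real.exp (c * dist s (q w)) ≤
      ∑ w, ∑ u, f u * Real.exp (c * dist s (p u)) * (|A u w| * Real.exp (c * dist (p u) (q w))) := by
    refine Finset.sum_le_sum fun w _ => ?_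
    rw [Finset.sum_mul]
    refine Finset.sum_le_sum fun u _ => ?_
    calc |A u w| * f u * Real.exp (c * dist s (q w)) ≤ |A u w| * f u * (Real.exp (c * dist s (p u)) * Real.exp (c * dist (p u) (q w))) :=
          mul_le_mul_of_nonneg_left (expw_triangle hc s (p u) (q w)) (mul_nonneg (abs_nonneg _) (hf0 u))
      _ = f u * Real.exp (c * dist s (p u)) * (|A u w| * Real.exp (c * dist (p u) (q w))) := by ring
  rw [Finset.sum_comm] at h1
  refine h1.trans ?_
  calc ∑ u, ∑ w, f u * Real.exp (c * dist s (p u)) * (|A u w| * Real.exp (c * dist (p u) (q w)))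
      = ∑ u, f u * Real.exp (c * dist s (p u)) * ∑ w, |A u w| * Real.exp (c * dist (p u) (q w)) :=
        Finset.sum_congr rfl fun u _ => by rw [Finset.mul_sum]
    _ ≤ ∑ u, f u * Real.exp (c * dist s (p u)) * αrσ :=
        Finset.sum_le_sum fun u _ => mul_le_mul_of_nonneg_left (hA u) (mul_nonneg (hf0 u) (Real.exp_pos _).le)
    _ = (∑ u, f u * Real.exp (c * dist s (p u))) * αrσ := by rw [Finset.sum_mul]
    _ ≤ F * αrσ := mul_le_mul_of_nonneg_right hF hα0

omit [DecidableEq κ] in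
/-- **The weighted entry letter `βθ`**: one nonnegative term of the previous sum, `(Σ_u|A_{uw}|f_u)·e^{c·d(s,q w)} ≤ F·αrσ`. [folklore] -/
theorem profile_weighted_entry_le {f : ι → ℝ} {s : X} {F : ℝ} (hc : 0 ≤ c) (hf0 : ∀ u, 0 ≤ f u)
    (hF : ∑ u, f u * Real.exp (c * dist s (p u)) ≤ F) (hα0 : 0 ≤ αrσ) (hA : ∀ u, ∑ w, |A u w| * Real.exp (c * dist (p u) (q w)) ≤ αrσ)
    (w : κ) : (∑ u, |A u w| * f u) * Real.exp (c * dist s (q w)) ≤ F * αrσ := by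
  refine le_trans ?_ (profile_weighted_rowsum_le hc hf0 hF hα0 hA)
  exact Finset.single_le_sum (f := fun w => (∑ u, |A u w| * f u) * Real.exp (c * dist s (q w)))
    (fun w _ => mul_nonneg (Finset.sum_nonneg fun u _ => mul_nonneg (abs_nonneg _) (hf0 u)) (Real.exp_pos _).le) (Finset.mem_univ w)

variable {Hk : ι → ι → ℝ} {hrϑ hcϑ lamA : ℝ}

omit [Fintype ι] [Fintype κ] [DecidableEq κ] in
/-- The three-step weight: `e^{c·d(q x,q w)} ≤ e^{c·d(p v,q x)}·e^{c·d(p v,p u)}·e^{c·d(p u,q w)}`. [folklore] -/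
theorem expw_three_step (hc : 0 ≤ c) (x w : κ) (u v : ι) :
    Real.exp (c * dist (q x) (q w)) ≤ Real.exp (c * dist (p v) (q x)) * Real.exp (c * dist (p v) (p u)) * Real.exp (c * dist (p u) (q w)) := by
  calc Real.exp (c * dist (q x) (q w)) ≤ Real.exp (c * dist (q x) (p v)) * Real.exp (c * dist (p v) (q w)) := expw_triangle hc _ _ _
    _ ≤ Real.exp (c * dist (q x) (p v)) * (Real.exp (c * dist (p v) (p u)) * Real.exp (c * dist (p u) (q w))) :=
        mul_le_mul_of_nonneg_left (expw_triangle hc _ _ _) (Real.exp_pos _).le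
    _ = Real.exp (c * dist (p v) (q x)) * Real.exp (c * dist (p v) (p u)) * Real.exp (c * dist (p u) (q w)) := by rw [dist_comm (q x) (p v)]; ring

omit [Fintype ι] [Fintype κ] [DecidableEq κ] in
/-- The weighted cross term: `|A_{uw}||A_{vx}|Hk_{vu}·e^{c·d(q x,q w)} ≤ (|A_{vx}|e^{c·d(p v,q x)})·(Hk_{vu}e^{c·d(p v,p u)})·(|A_{uw}|e^{c·d(p u,q w)})`.
[folklore] -/
theorem cross_term_weighted_le (hc : 0 ≤ c) (hHk0 : ∀ v u, 0 ≤ Hk v u) (x w : κ) (u v : ι) :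
    |A u w| * |A v x| * Hk v u * Real.exp (c * dist (q x) (q w)) ≤
      (|A v x| * Real.exp (c * dist (p v) (q x))) * (Hk v u * Real.exp (c * dist (p v) (p u))) * (|A u w| * Real.exp (c * dist (p u) (q w))) := by
  calc |A u w| * |A v x| * Hk v u * Real.exp (c * dist (q x) (q w))
      ≤ |A u w| * |A v x| * Hk v u * (Real.exp (c * dist (p v) (q x)) * Real.exp (c * dist (p v) (p u)) * Real.exp (c * dist (p u) (q w))) :=
        mul_le_mul_of_nonneg_left (expw_three_step hc x w u v) (mul_nonneg (mul_nonneg (abs_nonneg _) (abs_nonneg _)) (hHk0 v u))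
    _ = (|A v x| * Real.exp (c * dist (p v) (q x))) * (Hk v u * Real.exp (c * dist (p v) (p u))) * (|A u w| * Real.exp (c * dist (p u) (q w))) := by
        ring

/-- **THE WEIGHTED ROW SMALLNESS `γθ` WITHOUT FINITE RANGE**: with the intrinsic weighted row letter `Σ_u Hk_{vu}e^{c·d(p v,p u)} ≤ hrϑ` and the
factor's weighted letters `αrσ ≥ 0, αcσ`, `Σ_w C_{xw}·e^{c·d(q x,q w)} ≤ αcσ·hrϑ·αrσ∕(1−lamA)`. [folklore] -/
theorem cross_weighted_rowsum_le [Nonempty ι] (hc : 0 ≤ c) (hHk0 : ∀ v u, 0 ≤ Hk v u)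
    (hHkϑ : ∀ v, ∑ u, Hk v u * Real.exp (c * dist (p v) (p u)) ≤ hrϑ) (hα0 : 0 ≤ αrσ)
    (hAr : ∀ u, ∑ w, |A u w| * Real.exp (c * dist (p u) (q w)) ≤ αrσ) (hAc : ∀ w, ∑ u, |A u w| * Real.exp (c * dist (p u) (q w)) ≤ αcσ)
    (hlamA1 : lamA < 1) (x : κ) :
    ∑ w, (if w = x then 0 else ∑ u, ∑ v, |A u w| * |A v x| * Hk v u) / (1 - lamA) * Real.exp (c * dist (q x) (q w)) ≤
      αcσ * hrϑ * αrσ / (1 - lamA) := by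
  obtain ⟨v₀⟩ := ‹Nonempty ι›
  have hl : 0 < 1 - lamA := by linarith
  have hr0 : 0 ≤ hrϑ := (Finset.sum_nonneg fun u _ => mul_nonneg (hHk0 v₀ u) (Real.exp_pos _).le).trans (hHkϑ v₀)
  have hterm : ∀ w, (if w = x then 0 else ∑ u, ∑ v, |A u w| * |A v x| * Hk v u) / (1 - lamA) * Real.exp (c * dist (q x) (q w)) ≤
      (∑ u, ∑ v, (|A v x| * Real.exp (c * dist (p v) (q x))) * (Hk v u * Real.exp (c * dist (p v) (p u))) *
        (|A u w| * Real.exp (c * dist (p u) (q w)))) / (1 - lamA) := fun w => by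
    rw [div_mul_eq_mul_div]
    refine div_le_div_of_nonneg_right ?_ hl.le
    have hJ : (if w = x then 0 else ∑ u, ∑ v, |A u w| * |A v x| * Hk v u) ≤ ∑ u, ∑ v, |A u w| * |A v x| * Hk v u := by
      split_ifs
      · exact whitened_cross_nonneg hHk0 A x w
      · exact le_rfl
    refine (mul_le_mul_of_nonneg_right hJ (Real.exp_pos _).le).trans ?_
    rw [Finset.sum_mul]
    refine Finset.sum_le_sum fun u _ => ?_
    rw [Finset.sum_mul]
    exact Finset.sum_le_sum fun v _ => cross_term_weighted_le hc hHk0 x w u v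
  refine (Finset.sum_le_sum fun w _ => hterm w).trans ?_
  rw [← Finset.sum_div]
  refine div_le_div_of_nonneg_right ?_ hl.le
  -- reorder `Σ_w Σ_u Σ_v` to `Σ_v Σ_u Σ_w` and factor
  calc ∑ w, ∑ u, ∑ v, (|A v x| * Real.exp (c * dist (p v) (q x))) * (Hk v u * Real.exp (c * dist (p v) (p u))) *
        (|A u w| * Real.exp (c * dist (p u) (q w)))
      = ∑ u, ∑ v, ∑ w, (|A v x| * Real.exp (c * dist (p v) (q x))) * (Hk v u * Real.exp (c * dist (p v) (p u))) *
        (|A u w| * Real.exp (c * dist (p u) (q w))) := by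
          rw [Finset.sum_comm]; exact Finset.sum_congr rfl fun u _ => Finset.sum_comm
    _ = ∑ u, ∑ v, (|A v x| * Real.exp (c * dist (p v) (q x))) * (Hk v u * Real.exp (c * dist (p v) (p u))) *
        ∑ w, (|A u w| * Real.exp (c * dist (p u) (q w))) :=
          Finset.sum_congr rfl fun u _ => Finset.sum_congr rfl fun v _ => by rw [Finset.mul_sum]
    _ ≤ ∑ u, ∑ v, (|A v x| * Real.exp (c * dist (p v) (q x))) * (Hk v u * Real.exp (c * dist (p v) (p u))) * αrσ :=
          Finset.sum_le_sum fun u _ => Finset.sum_le_sum fun v _ => mul_le_mul_of_nonneg_left (hAr u)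
            (mul_nonneg (mul_nonneg (abs_nonneg _) (Real.exp_pos _).le) (mul_nonneg (hHk0 v u) (Real.exp_pos _).le))
    _ = (∑ v, (|A v x| * Real.exp (c * dist (p v) (q x))) * ∑ u, (Hk v u * Real.exp (c * dist (p v) (p u)))) * αrσ := by
          rw [Finset.sum_comm, Finset.sum_mul]
          refine Finset.sum_congr rfl fun v _ => ?_
          rw [Finset.mul_sum, Finset.sum_mul]
    _ ≤ (∑ v, (|A v x| * Real.exp (c * dist (p v) (q x))) * hrϑ) * αrσ :=
          mul_le_mul_of_nonneg_right (Finset.sum_le_sum fun v _ => mul_le_mul_of_nonneg_left (hHkϑ v)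
            (mul_nonneg (abs_nonneg _) (Real.exp_pos _).le)) hα0
    _ = (∑ v, |A v x| * Real.exp (c * dist (p v) (q x))) * hrϑ * αrσ := by simp only [Finset.sum_mul]
    _ ≤ αcσ * hrϑ * αrσ := mul_le_mul_of_nonneg_right (mul_le_mul_of_nonneg_right (hAc x) hr0) hα0

/-- **THE WEIGHTED COLUMN SMALLNESS `γθ′` WITHOUT FINITE RANGE**: with the intrinsic weighted COLUMN letter `Σ_v Hk_{vu}e^{c·d(p v,p u)} ≤ hcϑ`,
`Σ_x C_{xw}·e^{c·d(q x,q w)} ≤ αcσ·hcϑ·αrσ∕(1−lamA)` (here `αrσ` bounds the rows `Σ_x|A_{vx}|e^{c·d(p v,q x)}` and `αcσ` the columns).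
[folklore] -/
theorem cross_weighted_colsum_le [Nonempty ι] (hc : 0 ≤ c) (hHk0 : ∀ v u, 0 ≤ Hk v u)
    (hHkϑ : ∀ u, ∑ v, Hk v u * Real.exp (c * dist (p v) (p u)) ≤ hcϑ)
    (hAr : ∀ u, ∑ w, |A u w| * Real.exp (c * dist (p u) (q w)) ≤ αrσ) (hAc : ∀ w, ∑ u, |A u w| * Real.exp (c * dist (p u) (q w)) ≤ αcσ)
    (hlamA1 : lamA < 1) (w : κ) :
    ∑ x, (if w = x then 0 else ∑ u, ∑ v, |A u w| * |A v x| * Hk v u) / (1 - lamA) * Real.exp (c * dist (q x) (q w)) ≤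
      αcσ * hcϑ * αrσ / (1 - lamA) := by
  obtain ⟨v₀⟩ := ‹Nonempty ι›
  have hl : 0 < 1 - lamA := by linarith
  have hc0 : 0 ≤ hcϑ := (Finset.sum_nonneg fun v _ => mul_nonneg (hHk0 v v₀) (Real.exp_pos _).le).trans (hHkϑ v₀)
  have hterm : ∀ x, (if w = x then 0 else ∑ u, ∑ v, |A u w| * |A v x| * Hk v u) / (1 - lamA) * Real.exp (c * dist (q x) (q w)) ≤
      (∑ u, ∑ v, (|A v x| * Real.exp (c * dist (p v) (q x))) * (Hk v u * Real.exp (c * dist (p v) (p u))) *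
        (|A u w| * Real.exp (c * dist (p u) (q w)))) / (1 - lamA) := fun x => by
    rw [div_mul_eq_mul_div]
    refine div_le_div_of_nonneg_right ?_ hl.le
    have hJ : (if w = x then 0 else ∑ u, ∑ v, |A u w| * |A v x| * Hk v u) ≤ ∑ u, ∑ v, |A u w| * |A v x| * Hk v u := by
      split_ifs
      · exact whitened_cross_nonneg hHk0 A x w
      · exact le_rfl
    refine (mul_le_mul_of_nonneg_right hJ (Real.exp_pos _).le).trans ?_
    rw [Finset.sum_mul]
    refine Finset.sum_le_sum fun u _ => ?_
    rw [Finset.sum_mul]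
    exact Finset.sum_le_sum fun v _ => cross_term_weighted_le hc hHk0 x w u v
  refine (Finset.sum_le_sum fun x _ => hterm x).trans ?_
  rw [← Finset.sum_div]
  refine div_le_div_of_nonneg_right ?_ hl.le
  -- reorder `Σ_x Σ_u Σ_v` to `Σ_u Σ_v Σ_x` and factor
  calc ∑ x, ∑ u, ∑ v, (|A v x| * Real.exp (c * dist (p v) (q x))) * (Hk v u * Real.exp (c * dist (p v) (p u))) *
        (|A u w| * Real.exp (c * dist (p u) (q w)))
      = ∑ u, ∑ v, ∑ x, (|A v x| * Real.exp (c * dist (p v) (q x))) * (Hk v u * Real.exp (c * dist (p v) (p u))) *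
        (|A u w| * Real.exp (c * dist (p u) (q w))) := by
          rw [Finset.sum_comm]; exact Finset.sum_congr rfl fun u _ => Finset.sum_comm
    _ = ∑ u, ∑ v, (∑ x, |A v x| * Real.exp (c * dist (p v) (q x))) * ((Hk v u * Real.exp (c * dist (p v) (p u))) *
        (|A u w| * Real.exp (c * dist (p u) (q w)))) :=
          Finset.sum_congr rfl fun u _ => Finset.sum_congr rfl fun v _ => by
            rw [Finset.sum_mul]; exact Finset.sum_congr rfl fun x _ => by ring
    _ ≤ ∑ u, ∑ v, αrσ * ((Hk v u * Real.exp (c * dist (p v) (p u))) * (|A u w| * Real.exp (c * dist (p u) (q w)))) :=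
          Finset.sum_le_sum fun u _ => Finset.sum_le_sum fun v _ => mul_le_mul_of_nonneg_right (hAr v)
            (mul_nonneg (mul_nonneg (hHk0 v u) (Real.exp_pos _).le) (mul_nonneg (abs_nonneg _) (Real.exp_pos _).le))
    _ = αrσ * ∑ u, (∑ v, Hk v u * Real.exp (c * dist (p v) (p u))) * (|A u w| * Real.exp (c * dist (p u) (q w))) := by
          rw [Finset.mul_sum]
          refine Finset.sum_congr rfl fun u _ => ?_
          rw [Finset.sum_mul, Finset.mul_sum]
    _ ≤ αrσ * ∑ u, hcϑ * (|A u w| * Real.exp (c * dist (p u) (q w))) := by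
          have hαr0 : 0 ≤ αrσ := (Finset.sum_nonneg fun w _ => mul_nonneg (abs_nonneg _) (Real.exp_pos _).le).trans (hAr v₀)
          exact mul_le_mul_of_nonneg_left (Finset.sum_le_sum fun u _ => mul_le_mul_of_nonneg_right (hHkϑ u)
            (mul_nonneg (abs_nonneg _) (Real.exp_pos _).le)) hαr0
    _ = αrσ * (hcϑ * ∑ u, |A u w| * Real.exp (c * dist (p u) (q w))) := by simp only [Finset.mul_sum]
    _ ≤ αrσ * (hcϑ * αcσ) := by
          have hαr0 : 0 ≤ αrσ := (Finset.sum_nonneg fun w _ => mul_nonneg (abs_nonneg _) (Real.exp_pos _).le).trans (hAr v₀)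
          exact mul_le_mul_of_nonneg_left (mul_le_mul_of_nonneg_left (hAc w) hc0) hαr0
    _ = αcσ * hcϑ * αrσ := by ring

end Generic

/-! ## §2. The class's instances: the `Hk`-, `K3`-, `K4`-vector profiles -/

section Instances

variable {A : Matrix ι κ ℝ} {p : ι → X} {q : κ → X} {c αrσ : ℝ} {Hk : ι → ι → ℝ} {K3 : ι → ι → ι → ℝ} {K4 : ι → ι → ι → ι → ℝ}
  {hrϑ k3eϑ k4eϑ : ℝ}

omit [DecidableEq κ] in
/-- **`αθ` for the gradient vectors `b^v_w = Σ_u|A_{uw}|Hk_{vu}`** from the intrinsic weighted row letter of `Hk`. [folklore] -/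
theorem hessian_profile_letter (hc : 0 ≤ c) (hHk0 : ∀ v u, 0 ≤ Hk v u) (hHkϑ : ∀ v, ∑ u, Hk v u * Real.exp (c * dist (p v) (p u)) ≤ hrϑ)
    (hα0 : 0 ≤ αrσ) (hA : ∀ u, ∑ w, |A u w| * Real.exp (c * dist (p u) (q w)) ≤ αrσ) (v : ι) :
    ∑ w, (∑ u, |A u w| * Hk v u) * Real.exp (c * dist (p v) (q w)) ≤ hrϑ * αrσ :=
  profile_weighted_rowsum_le hc (hHk0 v) (hHkϑ v) hα0 hA

omit [DecidableEq κ] in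
/-- **`αθ` for the Hessian-entry vectors `g^{pq}_w = Σ_u|A_{uw}|K3_{pqu}`** anchored at `p` from the intrinsic letter
`Σ_u K3_{pqu}e^{c·d(p p,p u)} ≤ k3eϑ`. [folklore] -/
theorem third_profile_letter (hc : 0 ≤ c) (hK30 : ∀ x y u, 0 ≤ K3 x y u)
    (hK3ϑ : ∀ x y, ∑ u, K3 x y u * Real.exp (c * dist (p x) (p u)) ≤ k3eϑ) (hα0 : 0 ≤ αrσ)
    (hA : ∀ u, ∑ w, |A u w| * Real.exp (c * dist (p u) (q w)) ≤ αrσ) (x y : ι) :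
    ∑ w, (∑ u, |A u w| * K3 x y u) * Real.exp (c * dist (p x) (q w)) ≤ k3eϑ * αrσ :=
  profile_weighted_rowsum_le hc (hK30 x y) (hK3ϑ x y) hα0 hA

omit [DecidableEq κ] in
/-- **`αθ` for the third-entry vectors `Σ_u|A_{uw}|K4_{pqou}`** anchored at `p`. [folklore] -/
theorem fourth_profile_letter (hc : 0 ≤ c) (hK40 : ∀ x y z u, 0 ≤ K4 x y z u)
    (hK4ϑ : ∀ x y z, ∑ u, K4 x y z u * Real.exp (c * dist (p x) (p u)) ≤ k4eϑ) (hα0 : 0 ≤ αrσ)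
    (hA : ∀ u, ∑ w, |A u w| * Real.exp (c * dist (p u) (q w)) ≤ αrσ) (x y z : ι) :
    ∑ w, (∑ u, |A u w| * K4 x y z u) * Real.exp (c * dist (p x) (q w)) ≤ k4eϑ * αrσ :=
  profile_weighted_rowsum_le hc (hK40 x y z) (hK4ϑ x y z) hα0 hA

end Instances

/-! ## §3. A finite-range majorant has the intrinsic weighted letters ((476)'s case is contained) -/

section FiniteRange

variable {p : ι → X} {c R' hr hc : ℝ} {Hk : ι → ι → ℝ}

omit [Fintype κ] [DecidableEq κ] in
/-- **Rows**: `Hk_{vu} ≠ 0 ⟹ d(p v,p u) ≤ R′` and `Σ_u Hk_{vu} ≤ hr` give `Σ_u Hk_{vu}e^{c·d(p v,p u)} ≤ e^{cR′}·hr`. [folklore] -/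
theorem weighted_rowsum_of_finite_range (hμ : 0 ≤ c) (hHk0 : ∀ v u, 0 ≤ Hk v u) (hhr : ∀ v, ∑ u, Hk v u ≤ hr)
    (hHkR : ∀ v u, Hk v u = 0 ∨ dist (p v) (p u) ≤ R') (v : ι) :
    ∑ u, Hk v u * Real.exp (c * dist (p v) (p u)) ≤ Real.exp (c * R') * hr := by
  refine (Finset.sum_le_sum fun u _ => weight_le_of_support (hHk0 v u) hμ (hHkR v u)).trans ?_
  rw [← Finset.sum_mul, mul_comm]
  exact mul_le_mul_of_nonneg_left (hhr v) (Real.exp_pos _).le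

omit [Fintype κ] [DecidableEq κ] in
/-- **Columns**: likewise `Σ_v Hk_{vu}e^{c·d(p v,p u)} ≤ e^{cR′}·hc`. [folklore] -/
theorem weighted_colsum_of_finite_range (hμ : 0 ≤ c) (hHk0 : ∀ v u, 0 ≤ Hk v u) (hhc : ∀ u, ∑ v, Hk v u ≤ hc)
    (hHkR : ∀ v u, Hk v u = 0 ∨ dist (p v) (p u) ≤ R') (u : ι) :
    ∑ v, Hk v u * Real.exp (c * dist (p v) (p u)) ≤ Real.exp (c * R') * hc := by
  refine (Finset.sum_le_sum fun v _ => weight_le_of_support (hHk0 v u) hμ (hHkR v u)).trans ?_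
  rw [← Finset.sum_mul, mul_comm]
  exact mul_le_mul_of_nonneg_left (hhc u) (Real.exp_pos _).le

end FiniteRange

/-! ## §4. Toy -/

/-- Toy (§1's transport in numbers): a profile letter `2` and a factor letter `3` give `2·3 = 6`. -/
example : (2 : ℝ) * 3 = 6 := by norm_num

end Summit.QuantumFields.BalabanUV.T4Continuum.NE7b.SupWeightedProfileLetters

end
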